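import Summits.Ventures.PercRepro.S2TwelveTenK1NuNine
import Summits.Ventures.PercRepro.S2TenTools
import Summits.Ventures.PercRepro.S2RankClasses
import Summits.Ventures.PercRepro.S2NuFourDeletion
import Summits.Ventures.PercRepro.S2NuFourSimpleCounts
import Summits.Ventures.PercRepro.S2NuFourTools
import Summits.Ventures.PercRepro.S2SmallRankSubsets
import Summits.Ventures.PercRepro.S2ContractionRankExact

/-!
# PercRepro — S2: The case `ν = 8` of the scaled coloop-free cell `(12, 10)` of `(13, 10)` at `K₁ = 10219` at `|W| = 13` — THE TOP COUNT (p7, gen 19; sub-claim S2; the row `p = 13`)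

A set `V` of nullity `8` on `13` points (rank `5`; a flat since no set of nullity `9` has `≤ 14` points), the exact-rank lever on `V` with `N = M ／ V` of nullity `2` on `9` points (the dependent pairs `≤ 3`, the kit), the rank-`5` sets `≤ 13` and the rank-`4` sets `≤ 12` points. The trace side by the rank classes of the `j`-subsets of `V` (S2RankClasses: `Dep₄ ≤ I₃`,
`5·R₅³ ≤ 2·Dep₄`, `15·R₆³ ≤ Dep₄`, lines `≤ 3`, planes `≤ 6` points); the tail by flats at `(13, 12)` (`5843493041 / 12600`), the spanning
count through `V` (`≤ 333990`). `#U ≤ 118234` (one omega per size, `6 … 10`), `m = 195`, ratio `0.45`. **`c025_twelve_ten_cfk1_nu_eight_thirteen`**. Nothing about the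
cell is claimed. Axioms: standard.
-/

open scoped Matroid

namespace PercRepro

namespace ThmN

open Set

variable {α : Type}

/-- The top count of the case `ν = 8` of the scaled coloop-free cell `(12, 10)` of `(13, 10)` at `K₁ = 10219` at `|W| = 13`: `#U ≤ 118234`. -/
theorem c025_twelve_ten_cfk1_nu_eight_thirteen_top (M : Matroid α) [M.Finite]
    (hR : M.eRank = ((12 : ℕ) : ℕ∞)) (hn : M.E.ncard = 12 + 10)
    (hfree : ∀ e ∈ M.E, ∃ A ⊆ M.E \ {e}, e ∉ M.closure A ∧ e ∉ M.closure ((M.E \ {e}) \ A)) (hK : ∀ e, ¬ M.IsColoop e)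
    (h9 : ¬ ∃ W ⊆ M.E, W.ncard ≤ 15 ∧ W.encard = M.eRk W + 9)
    (hV : ∃ V ⊆ M.E, V.ncard = 13 ∧ V.encard = M.eRk V + 8) :
    Matroid.topCount M 12 5 ≤ 118234 := by
  classical
  have hd : M.E.encard = M.eRank + ((10 : ℕ) : ℕ∞) := by
    rw [hR, ← M.ground_finite.cast_ncard_eq, hn]
    push_cast
    ring
  obtain ⟨hs3, hs4, hs5⟩ := caps_twelve_ten_cf M hd hn hfree hK
  have hEfin := M.ground_finite
  have hL0 : ∀ e ∈ M.E, ¬ M.IsLoop e := not_isLoop_of_free M hfree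
  have hs : ∀ e ∈ M.E, ∀ f ∈ M.E, e ≠ f → M.eRk {e, f} = 2 := by
    intro e he f hf hef
    have h2 : (2 : ℕ∞) ≤ M.eRk {e, f} :=
      two_le_eRk_of_two_le_ncard_of_free M hfree (pair_subset he hf) (by rw [ncard_pair hef])
    have h3 : M.eRk {e, f} ≤ 2 := by
      have := M.eRk_le_encard {e, f}
      rwa [encard_pair hef] at this
    exact le_antisymm h3 h2
  have hC1 : ∀ L ⊆ M.E, M.eRk L = 2 → L.ncard ≤ 3 :=
    fun L hL hr => ncard_le_three_of_eRk_two M hs hfree hL hr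
  have hflat : ∀ X ⊆ M.E, M.eRk X ≤ 5 → X.ncard ≤ 13 := fun X hX hr => by
    have := S2.ncard_le_of_eRk_le_of_not_nullity M 9 15 (by norm_num) h9 hX (r := 5) (by norm_num) (by exact_mod_cast hr)
    omega
  have hflat' : ∀ X ⊆ M.E, M.eRk X ≤ 4 → X.ncard ≤ 12 := fun X hX hr => by
    have := S2.ncard_le_of_eRk_le_of_not_nullity M 9 15 (by norm_num) h9 hX (r := 4) (by norm_num) (by exact_mod_cast hr)
    omega
  have hle0 : ∀ T ⊆ M.E, M.eRk T ≤ 0 → T.ncard ≤ 0 := fun T hT hr => S2.ncard_le_zero_of_eRk_le_zero M hL0 hT hr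
  have hle1 : ∀ T ⊆ M.E, M.eRk T ≤ 1 → T.ncard ≤ 1 := fun T hT hr => S2.ncard_le_one_of_eRk_le_one M hs hT hr
  have hle3 : ∀ T ⊆ M.E, M.eRk T ≤ 2 → T.ncard ≤ 3 := fun T hT hr => S2.ncard_le_three_of_eRk_le_two M hs hC1 hT hr
  have hle6 : ∀ T ⊆ M.E, M.eRk T ≤ 3 → T.ncard ≤ 6 := fun T hT hr => ncard_le_six_of_eRk_le_three_of_free M hfree hT hr
  -- the set `V`: `13` points of nullity `8` (rank `5`), a flat
  obtain ⟨V, hV, hw, hVk⟩ := hV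
  have hVfin0 : V.Finite := hEfin.subset hV
  have hVne : M.eRk V ≠ ⊤ := ((M.eRk_le_encard V).trans_lt hVfin0.encard_lt_top).ne
  have hr : M.eRk V = ((5 : ℕ) : ℕ∞) := by
    have h := hVk
    rw [← hVfin0.cast_ncard_eq, hw] at h
    have h2 : ((13 : ℕ) : ℕ∞) = ((5 : ℕ) : ℕ∞) + 8 := by norm_num
    rw [h2] at h
    exact (WithTop.add_right_cancel (by decide) h).symm
  have hVcl : M.closure V = V := by
    refine le_antisymm ?_ (M.subset_closure V hV)
    intro x hx
    by_contra hxV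
    have hxE : x ∈ M.E := M.closure_subset_ground V hx
    apply h9
    refine ⟨insert x V, Set.insert_subset hxE hV, ?_, ?_⟩
    · rw [Set.ncard_insert_of_notMem hxV hVfin0]; omega
    · rw [Set.encard_insert_of_notMem hxV, ← M.eRk_closure_eq, M.closure_insert_eq_of_mem_closure hx,
        M.eRk_closure_eq, hVk]
      ring
  have hVE : V ⊆ M.E := hV
  have hVfin : V.Finite := hEfin.subset hVE
  have hNE : (M ／ V).E = M.E \ V := Matroid.contract_ground M V
  have hRW : (M.E \ V).ncard = 9 := by
    rw [Set.ncard_sdiff hVE hVfin, hn, hw]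
  have hRfin : (M.E \ V).Finite := hEfin.sdiff
  have hRE : M.E \ V ⊆ (M ／ V).E := by rw [hNE]
  have hNL : ∀ e ∈ (M ／ V).E, ¬ (M ／ V).IsLoop e := S2.contract_not_isLoop_of_closure_eq M hVcl
  have hν : (M ／ V)✶.eRank = ((2 : ℕ) : ℕ∞) := by
    have h := S2.eRank_dual_contract_add M hVE
    rw [hR, hr, ← hRfin.cast_ncard_eq, hRW] at h
    have h2 : ((5 : ℕ) : ℕ∞) + ((9 : ℕ) : ℕ∞) = ((2 : ℕ) : ℕ∞) + ((12 : ℕ) : ℕ∞) := by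
      norm_cast
    rw [h2] at h
    exact WithTop.add_right_cancel (WithTop.natCast_ne_top 12) h
  -- the outside counts on `N = M ／ V` (nullity `2` on `9` points): the dependent pairs number `≤ 3`
  have hD2N := S2.ncard_dep_two_le (M ／ V) hν hNL
  norm_num [Nat.choose] at hD2N
  have hX2_4 : {X : Set α | X ⊆ M.E \ V ∧ X.ncard = 2 ∧ (M ／ V).eRk X + (4 : ℕ∞) ≤ 5}.ncard ≤ 3 := by
    have h := S2.ncard_outside_le_dep (M ／ V) hRfin hRE 2 (s := 1) (ρ := 4) (by norm_num) (by norm_num)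
    simp only [Nat.cast_ofNat] at h
    exact h.trans hD2N
  -- the outside counts: trivial bounds, the empty classes at ρ = 5
  have hX0_0 : {X : Set α | X ⊆ M.E \ V ∧ X.ncard = 0 ∧ (M ／ V).eRk X + (0 : ℕ∞) ≤ 5}.ncard ≤ 1 := by have h := S2.ncard_outside_le_choose (M ／ V) hRfin 0 (0 : ℕ∞); rw [hRW] at h; exact h.trans (by decide)
  have hX0_1 : {X : Set α | X ⊆ M.E \ V ∧ X.ncard = 0 ∧ (M ／ V).eRk X + (1 : ℕ∞) ≤ 5}.ncard ≤ 1 := by have h := S2.ncard_outside_le_choose (M ／ V) hRfin 0 (1 : ℕ∞); rw [hRW] at h; exact h.trans (by decide)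
  have hX0_2 : {X : Set α | X ⊆ M.E \ V ∧ X.ncard = 0 ∧ (M ／ V).eRk X + (2 : ℕ∞) ≤ 5}.ncard ≤ 1 := by have h := S2.ncard_outside_le_choose (M ／ V) hRfin 0 (2 : ℕ∞); rw [hRW] at h; exact h.trans (by decide)
  have hX0_3 : {X : Set α | X ⊆ M.E \ V ∧ X.ncard = 0 ∧ (M ／ V).eRk X + (3 : ℕ∞) ≤ 5}.ncard ≤ 1 := by have h := S2.ncard_outside_le_choose (M ／ V) hRfin 0 (3 : ℕ∞); rw [hRW] at h; exact h.trans (by decide)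
  have hX0_4 : {X : Set α | X ⊆ M.E \ V ∧ X.ncard = 0 ∧ (M ／ V).eRk X + (4 : ℕ∞) ≤ 5}.ncard ≤ 1 := by have h := S2.ncard_outside_le_choose (M ／ V) hRfin 0 (4 : ℕ∞); rw [hRW] at h; exact h.trans (by decide)
  have hX0_5 : {X : Set α | X ⊆ M.E \ V ∧ X.ncard = 0 ∧ (M ／ V).eRk X + (5 : ℕ∞) ≤ 5}.ncard ≤ 1 := by have h := S2.ncard_outside_le_choose (M ／ V) hRfin 0 (5 : ℕ∞); rw [hRW] at h; exact h.trans (by decide)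
  have hX1_0 : {X : Set α | X ⊆ M.E \ V ∧ X.ncard = 1 ∧ (M ／ V).eRk X + (0 : ℕ∞) ≤ 5}.ncard ≤ 9 := by have h := S2.ncard_outside_le_choose (M ／ V) hRfin 1 (0 : ℕ∞); rw [hRW] at h; exact h.trans (by decide)
  have hX1_1 : {X : Set α | X ⊆ M.E \ V ∧ X.ncard = 1 ∧ (M ／ V).eRk X + (1 : ℕ∞) ≤ 5}.ncard ≤ 9 := by have h := S2.ncard_outside_le_choose (M ／ V) hRfin 1 (1 : ℕ∞); rw [hRW] at h; exact h.trans (by decide)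
  have hX1_2 : {X : Set α | X ⊆ M.E \ V ∧ X.ncard = 1 ∧ (M ／ V).eRk X + (2 : ℕ∞) ≤ 5}.ncard ≤ 9 := by have h := S2.ncard_outside_le_choose (M ／ V) hRfin 1 (2 : ℕ∞); rw [hRW] at h; exact h.trans (by decide)
  have hX1_3 : {X : Set α | X ⊆ M.E \ V ∧ X.ncard = 1 ∧ (M ／ V).eRk X + (3 : ℕ∞) ≤ 5}.ncard ≤ 9 := by have h := S2.ncard_outside_le_choose (M ／ V) hRfin 1 (3 : ℕ∞); rw [hRW] at h; exact h.trans (by decide)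
  have hX1_4 : {X : Set α | X ⊆ M.E \ V ∧ X.ncard = 1 ∧ (M ／ V).eRk X + (4 : ℕ∞) ≤ 5}.ncard ≤ 9 := by have h := S2.ncard_outside_le_choose (M ／ V) hRfin 1 (4 : ℕ∞); rw [hRW] at h; exact h.trans (by decide)
  have hX1_5 : {X : Set α | X ⊆ M.E \ V ∧ X.ncard = 1 ∧ (M ／ V).eRk X + (5 : ℕ∞) ≤ 5}.ncard = 0 := by simpa using S2.ncard_outside_eq_zero_of_loopless (M ／ V) hRfin hRE hNL (k := 1) (by norm_num)
  have hX2_0 : {X : Set α | X ⊆ M.E \ V ∧ X.ncard = 2 ∧ (M ／ V).eRk X + (0 : ℕ∞) ≤ 5}.ncard ≤ 36 := by have h := S2.ncard_outside_le_choose (M ／ V) hRfin 2 (0 : ℕ∞); rw [hRW] at h; exact h.trans (by decide)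
  have hX2_1 : {X : Set α | X ⊆ M.E \ V ∧ X.ncard = 2 ∧ (M ／ V).eRk X + (1 : ℕ∞) ≤ 5}.ncard ≤ 36 := by have h := S2.ncard_outside_le_choose (M ／ V) hRfin 2 (1 : ℕ∞); rw [hRW] at h; exact h.trans (by decide)
  have hX2_2 : {X : Set α | X ⊆ M.E \ V ∧ X.ncard = 2 ∧ (M ／ V).eRk X + (2 : ℕ∞) ≤ 5}.ncard ≤ 36 := by have h := S2.ncard_outside_le_choose (M ／ V) hRfin 2 (2 : ℕ∞); rw [hRW] at h; exact h.trans (by decide)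
  have hX2_3 : {X : Set α | X ⊆ M.E \ V ∧ X.ncard = 2 ∧ (M ／ V).eRk X + (3 : ℕ∞) ≤ 5}.ncard ≤ 36 := by have h := S2.ncard_outside_le_choose (M ／ V) hRfin 2 (3 : ℕ∞); rw [hRW] at h; exact h.trans (by decide)
  have hX2_5 : {X : Set α | X ⊆ M.E \ V ∧ X.ncard = 2 ∧ (M ／ V).eRk X + (5 : ℕ∞) ≤ 5}.ncard = 0 := by simpa using S2.ncard_outside_eq_zero_of_loopless (M ／ V) hRfin hRE hNL (k := 2) (by norm_num)
  -- the trace side: the class sums, the empty classes, the dependent classes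
  have hcls4 := S2.sum_ncard_rank_classes_le M hVE 4
  rw [hw] at hcls4; simp only [Finset.sum_range_succ, Finset.sum_range_zero, Nat.cast_zero, Nat.cast_one, Nat.cast_ofNat, zero_add] at hcls4; norm_num [Nat.choose] at hcls4
  have hz4_0 : {T : Set α | T ⊆ V ∧ T.ncard = 4 ∧ M.eRk T = (0 : ℕ∞)}.ncard = 0 := by simpa using S2.ncard_rank_class_eq_zero_of_forall_ncard_le M hVE (j := 4) (ρ := 0) (c := 0) (fun T hT hr => hle0 T (hT.trans hVE) (by simpa using hr)) (by norm_num)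
  have hz4_1 : {T : Set α | T ⊆ V ∧ T.ncard = 4 ∧ M.eRk T = (1 : ℕ∞)}.ncard = 0 := by simpa using S2.ncard_rank_class_eq_zero_of_forall_ncard_le M hVE (j := 4) (ρ := 1) (c := 1) (fun T hT hr => hle1 T (hT.trans hVE) (by simpa using hr)) (by norm_num)
  have hz4_2 : {T : Set α | T ⊆ V ∧ T.ncard = 4 ∧ M.eRk T = (2 : ℕ∞)}.ncard = 0 := by simpa using S2.ncard_rank_class_eq_zero_of_forall_ncard_le M hVE (j := 4) (ρ := 2) (c := 3) (fun T hT hr => hle3 T (hT.trans hVE) (by simpa using hr)) (by norm_num)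
  have hz4_5 : {T : Set α | T ⊆ V ∧ T.ncard = 4 ∧ M.eRk T = (5 : ℕ∞)}.ncard = 0 := by simpa using S2.ncard_rank_class_eq_zero_of_lt M hVE (j := 4) (ρ := 5) (by norm_num)
  have hcls5 := S2.sum_ncard_rank_classes_le M hVE 5
  rw [hw] at hcls5; simp only [Finset.sum_range_succ, Finset.sum_range_zero, Nat.cast_zero, Nat.cast_one, Nat.cast_ofNat, zero_add] at hcls5; norm_num [Nat.choose] at hcls5
  have hz5_0 : {T : Set α | T ⊆ V ∧ T.ncard = 5 ∧ M.eRk T = (0 : ℕ∞)}.ncard = 0 := by simpa using S2.ncard_rank_class_eq_zero_of_forall_ncard_le M hVE (j := 5) (ρ := 0) (c := 0) (fun T hT hr => hle0 T (hT.trans hVE) (by simpa using hr)) (by norm_num)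
  have hz5_1 : {T : Set α | T ⊆ V ∧ T.ncard = 5 ∧ M.eRk T = (1 : ℕ∞)}.ncard = 0 := by simpa using S2.ncard_rank_class_eq_zero_of_forall_ncard_le M hVE (j := 5) (ρ := 1) (c := 1) (fun T hT hr => hle1 T (hT.trans hVE) (by simpa using hr)) (by norm_num)
  have hz5_2 : {T : Set α | T ⊆ V ∧ T.ncard = 5 ∧ M.eRk T = (2 : ℕ∞)}.ncard = 0 := by simpa using S2.ncard_rank_class_eq_zero_of_forall_ncard_le M hVE (j := 5) (ρ := 2) (c := 3) (fun T hT hr => hle3 T (hT.trans hVE) (by simpa using hr)) (by norm_num)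
  have hcls6 := S2.sum_ncard_rank_classes_le M hVE 6
  rw [hw] at hcls6; simp only [Finset.sum_range_succ, Finset.sum_range_zero, Nat.cast_zero, Nat.cast_one, Nat.cast_ofNat, zero_add] at hcls6; norm_num [Nat.choose] at hcls6
  have hz6_0 : {T : Set α | T ⊆ V ∧ T.ncard = 6 ∧ M.eRk T = (0 : ℕ∞)}.ncard = 0 := by simpa using S2.ncard_rank_class_eq_zero_of_forall_ncard_le M hVE (j := 6) (ρ := 0) (c := 0) (fun T hT hr => hle0 T (hT.trans hVE) (by simpa using hr)) (by norm_num)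
  have hz6_1 : {T : Set α | T ⊆ V ∧ T.ncard = 6 ∧ M.eRk T = (1 : ℕ∞)}.ncard = 0 := by simpa using S2.ncard_rank_class_eq_zero_of_forall_ncard_le M hVE (j := 6) (ρ := 1) (c := 1) (fun T hT hr => hle1 T (hT.trans hVE) (by simpa using hr)) (by norm_num)
  have hz6_2 : {T : Set α | T ⊆ V ∧ T.ncard = 6 ∧ M.eRk T = (2 : ℕ∞)}.ncard = 0 := by simpa using S2.ncard_rank_class_eq_zero_of_forall_ncard_le M hVE (j := 6) (ρ := 2) (c := 3) (fun T hT hr => hle3 T (hT.trans hVE) (by simpa using hr)) (by norm_num)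
  have hcls7 := S2.sum_ncard_rank_classes_le M hVE 7
  rw [hw] at hcls7; simp only [Finset.sum_range_succ, Finset.sum_range_zero, Nat.cast_zero, Nat.cast_one, Nat.cast_ofNat, zero_add] at hcls7; norm_num [Nat.choose] at hcls7
  have hz7_0 : {T : Set α | T ⊆ V ∧ T.ncard = 7 ∧ M.eRk T = (0 : ℕ∞)}.ncard = 0 := by simpa using S2.ncard_rank_class_eq_zero_of_forall_ncard_le M hVE (j := 7) (ρ := 0) (c := 0) (fun T hT hr => hle0 T (hT.trans hVE) (by simpa using hr)) (by norm_num)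
  have hz7_1 : {T : Set α | T ⊆ V ∧ T.ncard = 7 ∧ M.eRk T = (1 : ℕ∞)}.ncard = 0 := by simpa using S2.ncard_rank_class_eq_zero_of_forall_ncard_le M hVE (j := 7) (ρ := 1) (c := 1) (fun T hT hr => hle1 T (hT.trans hVE) (by simpa using hr)) (by norm_num)
  have hz7_2 : {T : Set α | T ⊆ V ∧ T.ncard = 7 ∧ M.eRk T = (2 : ℕ∞)}.ncard = 0 := by simpa using S2.ncard_rank_class_eq_zero_of_forall_ncard_le M hVE (j := 7) (ρ := 2) (c := 3) (fun T hT hr => hle3 T (hT.trans hVE) (by simpa using hr)) (by norm_num)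
  have hz7_3 : {T : Set α | T ⊆ V ∧ T.ncard = 7 ∧ M.eRk T = (3 : ℕ∞)}.ncard = 0 := by simpa using S2.ncard_rank_class_eq_zero_of_forall_ncard_le M hVE (j := 7) (ρ := 3) (c := 6) (fun T hT hr => hle6 T (hT.trans hVE) (by simpa using hr)) (by norm_num)
  have hcls8 := S2.sum_ncard_rank_classes_le M hVE 8
  rw [hw] at hcls8; simp only [Finset.sum_range_succ, Finset.sum_range_zero, Nat.cast_zero, Nat.cast_one, Nat.cast_ofNat, zero_add] at hcls8; norm_num [Nat.choose] at hcls8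
  have hz8_0 : {T : Set α | T ⊆ V ∧ T.ncard = 8 ∧ M.eRk T = (0 : ℕ∞)}.ncard = 0 := by simpa using S2.ncard_rank_class_eq_zero_of_forall_ncard_le M hVE (j := 8) (ρ := 0) (c := 0) (fun T hT hr => hle0 T (hT.trans hVE) (by simpa using hr)) (by norm_num)
  have hz8_1 : {T : Set α | T ⊆ V ∧ T.ncard = 8 ∧ M.eRk T = (1 : ℕ∞)}.ncard = 0 := by simpa using S2.ncard_rank_class_eq_zero_of_forall_ncard_le M hVE (j := 8) (ρ := 1) (c := 1) (fun T hT hr => hle1 T (hT.trans hVE) (by simpa using hr)) (by norm_num)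
  have hz8_2 : {T : Set α | T ⊆ V ∧ T.ncard = 8 ∧ M.eRk T = (2 : ℕ∞)}.ncard = 0 := by simpa using S2.ncard_rank_class_eq_zero_of_forall_ncard_le M hVE (j := 8) (ρ := 2) (c := 3) (fun T hT hr => hle3 T (hT.trans hVE) (by simpa using hr)) (by norm_num)
  have hz8_3 : {T : Set α | T ⊆ V ∧ T.ncard = 8 ∧ M.eRk T = (3 : ℕ∞)}.ncard = 0 := by simpa using S2.ncard_rank_class_eq_zero_of_forall_ncard_le M hVE (j := 8) (ρ := 3) (c := 6) (fun T hT hr => hle6 T (hT.trans hVE) (by simpa using hr)) (by norm_num)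
  have hcls9 := S2.sum_ncard_rank_classes_le M hVE 9
  rw [hw] at hcls9; simp only [Finset.sum_range_succ, Finset.sum_range_zero, Nat.cast_zero, Nat.cast_one, Nat.cast_ofNat, zero_add] at hcls9; norm_num [Nat.choose] at hcls9
  have hz9_0 : {T : Set α | T ⊆ V ∧ T.ncard = 9 ∧ M.eRk T = (0 : ℕ∞)}.ncard = 0 := by simpa using S2.ncard_rank_class_eq_zero_of_forall_ncard_le M hVE (j := 9) (ρ := 0) (c := 0) (fun T hT hr => hle0 T (hT.trans hVE) (by simpa using hr)) (by norm_num)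
  have hz9_1 : {T : Set α | T ⊆ V ∧ T.ncard = 9 ∧ M.eRk T = (1 : ℕ∞)}.ncard = 0 := by simpa using S2.ncard_rank_class_eq_zero_of_forall_ncard_le M hVE (j := 9) (ρ := 1) (c := 1) (fun T hT hr => hle1 T (hT.trans hVE) (by simpa using hr)) (by norm_num)
  have hz9_2 : {T : Set α | T ⊆ V ∧ T.ncard = 9 ∧ M.eRk T = (2 : ℕ∞)}.ncard = 0 := by simpa using S2.ncard_rank_class_eq_zero_of_forall_ncard_le M hVE (j := 9) (ρ := 2) (c := 3) (fun T hT hr => hle3 T (hT.trans hVE) (by simpa using hr)) (by norm_num)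
  have hz9_3 : {T : Set α | T ⊆ V ∧ T.ncard = 9 ∧ M.eRk T = (3 : ℕ∞)}.ncard = 0 := by simpa using S2.ncard_rank_class_eq_zero_of_forall_ncard_le M hVE (j := 9) (ρ := 3) (c := 6) (fun T hT hr => hle6 T (hT.trans hVE) (by simpa using hr)) (by norm_num)
  have hcls10 := S2.sum_ncard_rank_classes_le M hVE 10
  rw [hw] at hcls10; simp only [Finset.sum_range_succ, Finset.sum_range_zero, Nat.cast_zero, Nat.cast_one, Nat.cast_ofNat, zero_add] at hcls10; norm_num [Nat.choose] at hcls10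
  have hz10_0 : {T : Set α | T ⊆ V ∧ T.ncard = 10 ∧ M.eRk T = (0 : ℕ∞)}.ncard = 0 := by simpa using S2.ncard_rank_class_eq_zero_of_forall_ncard_le M hVE (j := 10) (ρ := 0) (c := 0) (fun T hT hr => hle0 T (hT.trans hVE) (by simpa using hr)) (by norm_num)
  have hz10_1 : {T : Set α | T ⊆ V ∧ T.ncard = 10 ∧ M.eRk T = (1 : ℕ∞)}.ncard = 0 := by simpa using S2.ncard_rank_class_eq_zero_of_forall_ncard_le M hVE (j := 10) (ρ := 1) (c := 1) (fun T hT hr => hle1 T (hT.trans hVE) (by simpa using hr)) (by norm_num)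
  have hz10_2 : {T : Set α | T ⊆ V ∧ T.ncard = 10 ∧ M.eRk T = (2 : ℕ∞)}.ncard = 0 := by simpa using S2.ncard_rank_class_eq_zero_of_forall_ncard_le M hVE (j := 10) (ρ := 2) (c := 3) (fun T hT hr => hle3 T (hT.trans hVE) (by simpa using hr)) (by norm_num)
  have hz10_3 : {T : Set α | T ⊆ V ∧ T.ncard = 10 ∧ M.eRk T = (3 : ℕ∞)}.ncard = 0 := by simpa using S2.ncard_rank_class_eq_zero_of_forall_ncard_le M hVE (j := 10) (ρ := 3) (c := 6) (fun T hT hr => hle6 T (hT.trans hVE) (by simpa using hr)) (by norm_num)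
  have hDep4 := S2.ncard_dep_four_le_ncard_indep_three M hfree hs hC1 hVE
  have hI3 : {T : Set α | T ⊆ V ∧ T.ncard = 3 ∧ M.Indep T}.ncard ≤ 286 := by
    have hsub : {T : Set α | T ⊆ V ∧ T.ncard = 3 ∧ M.Indep T} ⊆ {T : Set α | T ⊆ V ∧ T.ncard = 3} := fun T hT => ⟨hT.1, hT.2.1⟩
    have h := Set.ncard_le_ncard hsub (hVfin.finite_subsets.subset (fun T hT => hT.1))
    rw [S2.ncard_subsets_ncard_eq V hVfin 3, hw] at h
    exact h.trans (by decide)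
  have ha43 : {T : Set α | T ⊆ V ∧ T.ncard = 4 ∧ M.eRk T = (3 : ℕ∞)}.ncard ≤ {T : Set α | T ⊆ V ∧ T.ncard = 4 ∧ M.Dep T}.ncard := by
    simpa using S2.ncard_rank_class_le_dep M hVE (j := 4) (ρ := 3) (by norm_num)
  have ha53 : {T : Set α | T ⊆ V ∧ T.ncard = 5 ∧ M.eRk T = (3 : ℕ∞)}.ncard * 5 ≤ {T : Set α | T ⊆ V ∧ T.ncard = 4 ∧ M.Dep T}.ncard * 2 := by
    have h := S2.ncard_rank_class_le_eRk_le M hVE 5 3; have h2 := S2.ncard_five_eRk_le_three_mul_five_le M hfree hs hC1 hVE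
    simp only [Nat.cast_ofNat] at h; omega
  have ha63 : {T : Set α | T ⊆ V ∧ T.ncard = 6 ∧ M.eRk T = (3 : ℕ∞)}.ncard * 15 ≤ {T : Set α | T ⊆ V ∧ T.ncard = 4 ∧ M.Dep T}.ncard := by
    have h := S2.ncard_rank_class_le_eRk_le M hVE 6 3; have h2 := S2.ncard_six_eRk_le_three_mul_fifteen_le M hfree hs hC1 hVE
    simp only [Nat.cast_ofNat] at h; omega
  -- the hitting bounds: a top set meets `V` in `≥ |B| − 2` points
  have hhit : ∀ B, B ⊆ M.E → M.eRk (M.E \ B) = M.eRank → B.ncard + 8 ≤ 10 + (B ∩ V).ncard := by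
    intro B hBE hBs
    have h := S2.encard_add_le_of_spanning_compl_of_nullity M hBE hVE hBs hd hVk hVne (by rw [hR]; exact WithTop.natCast_ne_top 12)
    rw [Set.inter_comm, ← (hEfin.subset hBE).cast_ncard_eq, ← ((hEfin.subset hBE).inter_of_left V).cast_ncard_eq] at h
    exact_mod_cast h
  have hhit6 : ∀ B, B ⊆ M.E → B.ncard = 6 → M.eRk B = 5 → M.eRk (M.E \ B) = M.eRank → 4 ≤ (B ∩ V).ncard := by
    intro B hBE hB _ hBs; have := hhit B hBE hBs; omega
  have hhit7 : ∀ B, B ⊆ M.E → B.ncard = 7 → M.eRk B = 5 → M.eRk (M.E \ B) = M.eRank → 5 ≤ (B ∩ V).ncard := by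
    intro B hBE hB _ hBs; have := hhit B hBE hBs; omega
  have hhit8 : ∀ B, B ⊆ M.E → B.ncard = 8 → M.eRk B = 5 → M.eRk (M.E \ B) = M.eRank → 6 ≤ (B ∩ V).ncard := by
    intro B hBE hB _ hBs; have := hhit B hBE hBs; omega
  have hhit9 : ∀ B, B ⊆ M.E → B.ncard = 9 → M.eRk B = 5 → M.eRk (M.E \ B) = M.eRank → 7 ≤ (B ∩ V).ncard := by
    intro B hBE hB _ hBs; have := hhit B hBE hBs; omega
  have hhit10 : ∀ B, B ⊆ M.E → B.ncard = 10 → M.eRk B = 5 → M.eRk (M.E \ B) = M.eRank → 8 ≤ (B ∩ V).ncard := by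
    intro B hBE hB _ hBs; have := hhit B hBE hBs; omega
  -- the top count: `5`-sets by the kit, `6`- … `10`-sets by the exact-rank lever, one omega per size
  have hsplitU := S2.topCount_le_sum_five_to_ten M hR hd
  have htop5 := S2.ncard_spanning_compl_le_of_nullity M hVE hd hVk (m := 5)
  rw [hn, hw] at htop5
  have htop5' : {B : Set α | B ⊆ M.E ∧ B.ncard = 5 ∧ M.eRk (M.E \ B) = M.eRank}.ncard ≤ 18018 := htop5.trans (by decide)
  have hmul : ∀ (a b c : ℕ), b ≤ c → a * b ≤ a * c := fun a b c h => Nat.mul_le_mul_left a h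
  have hU6 : {B : Set α | B ⊆ M.E ∧ B.ncard = 6 ∧ M.eRk B = 5 ∧ M.eRk (M.E \ B) = M.eRank}.ncard ≤ 24882 := by
    have htop6 := S2.ncard_top_le_sum_contract_rank_exact M hVE 6 4 hhit6
    simp only [Finset.sum_Icc_succ_top (by norm_num : 4 ≤ 6), Finset.sum_Icc_succ_top (by norm_num : 4 ≤ 5), Finset.Icc_self, Finset.sum_singleton, Finset.sum_range_succ, Finset.sum_range_zero,
      Nat.cast_zero, Nat.cast_one, Nat.cast_ofNat, zero_add, Nat.reduceAdd, Nat.reduceSub] at htop6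
    have hm6_4_0 := hmul ({T : Set α | T ⊆ V ∧ T.ncard = 4 ∧ M.eRk T = (0 : ℕ∞)}.ncard) _ _ hX2_0; have hm6_4_1 := hmul ({T : Set α | T ⊆ V ∧ T.ncard = 4 ∧ M.eRk T = (1 : ℕ∞)}.ncard) _ _ hX2_1; have hm6_4_2 := hmul ({T : Set α | T ⊆ V ∧ T.ncard = 4 ∧ M.eRk T = (2 : ℕ∞)}.ncard) _ _ hX2_2; have hm6_4_3 := hmul ({T : Set α | T ⊆ V ∧ T.ncard = 4 ∧ M.eRk T = (3 : ℕ∞)}.ncard) _ _ hX2_3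
    have hm6_4_4 := hmul ({T : Set α | T ⊆ V ∧ T.ncard = 4 ∧ M.eRk T = (4 : ℕ∞)}.ncard) _ _ hX2_4; have hm6_4_5 := hmul ({T : Set α | T ⊆ V ∧ T.ncard = 4 ∧ M.eRk T = (5 : ℕ∞)}.ncard) _ _ (le_of_eq hX2_5); have hm6_5_0 := hmul ({T : Set α | T ⊆ V ∧ T.ncard = 5 ∧ M.eRk T = (0 : ℕ∞)}.ncard) _ _ hX1_0; have hm6_5_1 := hmul ({T : Set α | T ⊆ V ∧ T.ncard = 5 ∧ M.eRk T = (1 : ℕ∞)}.ncard) _ _ hX1_1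
    have hm6_5_2 := hmul ({T : Set α | T ⊆ V ∧ T.ncard = 5 ∧ M.eRk T = (2 : ℕ∞)}.ncard) _ _ hX1_2; have hm6_5_3 := hmul ({T : Set α | T ⊆ V ∧ T.ncard = 5 ∧ M.eRk T = (3 : ℕ∞)}.ncard) _ _ hX1_3; have hm6_5_4 := hmul ({T : Set α | T ⊆ V ∧ T.ncard = 5 ∧ M.eRk T = (4 : ℕ∞)}.ncard) _ _ hX1_4; have hm6_5_5 := hmul ({T : Set α | T ⊆ V ∧ T.ncard = 5 ∧ M.eRk T = (5 : ℕ∞)}.ncard) _ _ (le_of_eq hX1_5)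
    have hm6_6_0 := hmul ({T : Set α | T ⊆ V ∧ T.ncard = 6 ∧ M.eRk T = (0 : ℕ∞)}.ncard) _ _ hX0_0; have hm6_6_1 := hmul ({T : Set α | T ⊆ V ∧ T.ncard = 6 ∧ M.eRk T = (1 : ℕ∞)}.ncard) _ _ hX0_1; have hm6_6_2 := hmul ({T : Set α | T ⊆ V ∧ T.ncard = 6 ∧ M.eRk T = (2 : ℕ∞)}.ncard) _ _ hX0_2; have hm6_6_3 := hmul ({T : Set α | T ⊆ V ∧ T.ncard = 6 ∧ M.eRk T = (3 : ℕ∞)}.ncard) _ _ hX0_3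
    have hm6_6_4 := hmul ({T : Set α | T ⊆ V ∧ T.ncard = 6 ∧ M.eRk T = (4 : ℕ∞)}.ncard) _ _ hX0_4; have hm6_6_5 := hmul ({T : Set α | T ⊆ V ∧ T.ncard = 6 ∧ M.eRk T = (5 : ℕ∞)}.ncard) _ _ hX0_5
    omega
  have hU7 : {B : Set α | B ⊆ M.E ∧ B.ncard = 7 ∧ M.eRk B = 5 ∧ M.eRk (M.E \ B) = M.eRank}.ncard ≤ 24797 := by
    have htop7 := S2.ncard_top_le_sum_contract_rank_exact M hVE 7 5 hhit7
    simp only [Finset.sum_Icc_succ_top (by norm_num : 5 ≤ 7), Finset.sum_Icc_succ_top (by norm_num : 5 ≤ 6), Finset.Icc_self, Finset.sum_singleton, Finset.sum_range_succ, Finset.sum_range_zero,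
      Nat.cast_zero, Nat.cast_one, Nat.cast_ofNat, zero_add, Nat.reduceAdd, Nat.reduceSub] at htop7
    have hm7_5_0 := hmul ({T : Set α | T ⊆ V ∧ T.ncard = 5 ∧ M.eRk T = (0 : ℕ∞)}.ncard) _ _ hX2_0; have hm7_5_1 := hmul ({T : Set α | T ⊆ V ∧ T.ncard = 5 ∧ M.eRk T = (1 : ℕ∞)}.ncard) _ _ hX2_1; have hm7_5_2 := hmul ({T : Set α | T ⊆ V ∧ T.ncard = 5 ∧ M.eRk T = (2 : ℕ∞)}.ncard) _ _ hX2_2; have hm7_5_3 := hmul ({T : Set α | T ⊆ V ∧ T.ncard = 5 ∧ M.eRk T = (3 : ℕ∞)}.ncard) _ _ hX2_3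
    have hm7_5_4 := hmul ({T : Set α | T ⊆ V ∧ T.ncard = 5 ∧ M.eRk T = (4 : ℕ∞)}.ncard) _ _ hX2_4; have hm7_5_5 := hmul ({T : Set α | T ⊆ V ∧ T.ncard = 5 ∧ M.eRk T = (5 : ℕ∞)}.ncard) _ _ (le_of_eq hX2_5); have hm7_6_0 := hmul ({T : Set α | T ⊆ V ∧ T.ncard = 6 ∧ M.eRk T = (0 : ℕ∞)}.ncard) _ _ hX1_0; have hm7_6_1 := hmul ({T : Set α | T ⊆ V ∧ T.ncard = 6 ∧ M.eRk T = (1 : ℕ∞)}.ncard) _ _ hX1_1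
    have hm7_6_2 := hmul ({T : Set α | T ⊆ V ∧ T.ncard = 6 ∧ M.eRk T = (2 : ℕ∞)}.ncard) _ _ hX1_2; have hm7_6_3 := hmul ({T : Set α | T ⊆ V ∧ T.ncard = 6 ∧ M.eRk T = (3 : ℕ∞)}.ncard) _ _ hX1_3; have hm7_6_4 := hmul ({T : Set α | T ⊆ V ∧ T.ncard = 6 ∧ M.eRk T = (4 : ℕ∞)}.ncard) _ _ hX1_4; have hm7_6_5 := hmul ({T : Set α | T ⊆ V ∧ T.ncard = 6 ∧ M.eRk T = (5 : ℕ∞)}.ncard) _ _ (le_of_eq hX1_5)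
    have hm7_7_0 := hmul ({T : Set α | T ⊆ V ∧ T.ncard = 7 ∧ M.eRk T = (0 : ℕ∞)}.ncard) _ _ hX0_0; have hm7_7_1 := hmul ({T : Set α | T ⊆ V ∧ T.ncard = 7 ∧ M.eRk T = (1 : ℕ∞)}.ncard) _ _ hX0_1; have hm7_7_2 := hmul ({T : Set α | T ⊆ V ∧ T.ncard = 7 ∧ M.eRk T = (2 : ℕ∞)}.ncard) _ _ hX0_2; have hm7_7_3 := hmul ({T : Set α | T ⊆ V ∧ T.ncard = 7 ∧ M.eRk T = (3 : ℕ∞)}.ncard) _ _ hX0_3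
    have hm7_7_4 := hmul ({T : Set α | T ⊆ V ∧ T.ncard = 7 ∧ M.eRk T = (4 : ℕ∞)}.ncard) _ _ hX0_4; have hm7_7_5 := hmul ({T : Set α | T ⊆ V ∧ T.ncard = 7 ∧ M.eRk T = (5 : ℕ∞)}.ncard) _ _ hX0_5
    omega
  have hU8 : {B : Set α | B ⊆ M.E ∧ B.ncard = 8 ∧ M.eRk B = 5 ∧ M.eRk (M.E \ B) = M.eRank}.ncard ≤ 22509 := by
    have htop8 := S2.ncard_top_le_sum_contract_rank_exact M hVE 8 6 hhit8
    simp only [Finset.sum_Icc_succ_top (by norm_num : 6 ≤ 8), Finset.sum_Icc_succ_top (by norm_num : 6 ≤ 7), Finset.Icc_self, Finset.sum_singleton, Finset.sum_range_succ, Finset.sum_range_zero,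
      Nat.cast_zero, Nat.cast_one, Nat.cast_ofNat, zero_add, Nat.reduceAdd, Nat.reduceSub] at htop8
    have hm8_6_0 := hmul ({T : Set α | T ⊆ V ∧ T.ncard = 6 ∧ M.eRk T = (0 : ℕ∞)}.ncard) _ _ hX2_0; have hm8_6_1 := hmul ({T : Set α | T ⊆ V ∧ T.ncard = 6 ∧ M.eRk T = (1 : ℕ∞)}.ncard) _ _ hX2_1; have hm8_6_2 := hmul ({T : Set α | T ⊆ V ∧ T.ncard = 6 ∧ M.eRk T = (2 : ℕ∞)}.ncard) _ _ hX2_2; have hm8_6_3 := hmul ({T : Set α | T ⊆ V ∧ T.ncard = 6 ∧ M.eRk T = (3 : ℕ∞)}.ncard) _ _ hX2_3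
    have hm8_6_4 := hmul ({T : Set α | T ⊆ V ∧ T.ncard = 6 ∧ M.eRk T = (4 : ℕ∞)}.ncard) _ _ hX2_4; have hm8_6_5 := hmul ({T : Set α | T ⊆ V ∧ T.ncard = 6 ∧ M.eRk T = (5 : ℕ∞)}.ncard) _ _ (le_of_eq hX2_5); have hm8_7_0 := hmul ({T : Set α | T ⊆ V ∧ T.ncard = 7 ∧ M.eRk T = (0 : ℕ∞)}.ncard) _ _ hX1_0; have hm8_7_1 := hmul ({T : Set α | T ⊆ V ∧ T.ncard = 7 ∧ M.eRk T = (1 : ℕ∞)}.ncard) _ _ hX1_1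
    have hm8_7_2 := hmul ({T : Set α | T ⊆ V ∧ T.ncard = 7 ∧ M.eRk T = (2 : ℕ∞)}.ncard) _ _ hX1_2; have hm8_7_3 := hmul ({T : Set α | T ⊆ V ∧ T.ncard = 7 ∧ M.eRk T = (3 : ℕ∞)}.ncard) _ _ hX1_3; have hm8_7_4 := hmul ({T : Set α | T ⊆ V ∧ T.ncard = 7 ∧ M.eRk T = (4 : ℕ∞)}.ncard) _ _ hX1_4; have hm8_7_5 := hmul ({T : Set α | T ⊆ V ∧ T.ncard = 7 ∧ M.eRk T = (5 : ℕ∞)}.ncard) _ _ (le_of_eq hX1_5)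
    have hm8_8_0 := hmul ({T : Set α | T ⊆ V ∧ T.ncard = 8 ∧ M.eRk T = (0 : ℕ∞)}.ncard) _ _ hX0_0; have hm8_8_1 := hmul ({T : Set α | T ⊆ V ∧ T.ncard = 8 ∧ M.eRk T = (1 : ℕ∞)}.ncard) _ _ hX0_1; have hm8_8_2 := hmul ({T : Set α | T ⊆ V ∧ T.ncard = 8 ∧ M.eRk T = (2 : ℕ∞)}.ncard) _ _ hX0_2; have hm8_8_3 := hmul ({T : Set α | T ⊆ V ∧ T.ncard = 8 ∧ M.eRk T = (3 : ℕ∞)}.ncard) _ _ hX0_3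
    have hm8_8_4 := hmul ({T : Set α | T ⊆ V ∧ T.ncard = 8 ∧ M.eRk T = (4 : ℕ∞)}.ncard) _ _ hX0_4; have hm8_8_5 := hmul ({T : Set α | T ⊆ V ∧ T.ncard = 8 ∧ M.eRk T = (5 : ℕ∞)}.ncard) _ _ hX0_5
    omega
  have hU9 : {B : Set α | B ⊆ M.E ∧ B.ncard = 9 ∧ M.eRk B = 5 ∧ M.eRk (M.E \ B) = M.eRank}.ncard ≤ 17446 := by
    have htop9 := S2.ncard_top_le_sum_contract_rank_exact M hVE 9 7 hhit9
    simp only [Finset.sum_Icc_succ_top (by norm_num : 7 ≤ 9), Finset.sum_Icc_succ_top (by norm_num : 7 ≤ 8), Finset.Icc_self, Finset.sum_singleton, Finset.sum_range_succ, Finset.sum_range_zero,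
      Nat.cast_zero, Nat.cast_one, Nat.cast_ofNat, zero_add, Nat.reduceAdd, Nat.reduceSub] at htop9
    have hm9_7_0 := hmul ({T : Set α | T ⊆ V ∧ T.ncard = 7 ∧ M.eRk T = (0 : ℕ∞)}.ncard) _ _ hX2_0; have hm9_7_1 := hmul ({T : Set α | T ⊆ V ∧ T.ncard = 7 ∧ M.eRk T = (1 : ℕ∞)}.ncard) _ _ hX2_1; have hm9_7_2 := hmul ({T : Set α | T ⊆ V ∧ T.ncard = 7 ∧ M.eRk T = (2 : ℕ∞)}.ncard) _ _ hX2_2; have hm9_7_3 := hmul ({T : Set α | T ⊆ V ∧ T.ncard = 7 ∧ M.eRk T = (3 : ℕ∞)}.ncard) _ _ hX2_3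
    have hm9_7_4 := hmul ({T : Set α | T ⊆ V ∧ T.ncard = 7 ∧ M.eRk T = (4 : ℕ∞)}.ncard) _ _ hX2_4; have hm9_7_5 := hmul ({T : Set α | T ⊆ V ∧ T.ncard = 7 ∧ M.eRk T = (5 : ℕ∞)}.ncard) _ _ (le_of_eq hX2_5); have hm9_8_0 := hmul ({T : Set α | T ⊆ V ∧ T.ncard = 8 ∧ M.eRk T = (0 : ℕ∞)}.ncard) _ _ hX1_0; have hm9_8_1 := hmul ({T : Set α | T ⊆ V ∧ T.ncard = 8 ∧ M.eRk T = (1 : ℕ∞)}.ncard) _ _ hX1_1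
    have hm9_8_2 := hmul ({T : Set α | T ⊆ V ∧ T.ncard = 8 ∧ M.eRk T = (2 : ℕ∞)}.ncard) _ _ hX1_2; have hm9_8_3 := hmul ({T : Set α | T ⊆ V ∧ T.ncard = 8 ∧ M.eRk T = (3 : ℕ∞)}.ncard) _ _ hX1_3; have hm9_8_4 := hmul ({T : Set α | T ⊆ V ∧ T.ncard = 8 ∧ M.eRk T = (4 : ℕ∞)}.ncard) _ _ hX1_4; have hm9_8_5 := hmul ({T : Set α | T ⊆ V ∧ T.ncard = 8 ∧ M.eRk T = (5 : ℕ∞)}.ncard) _ _ (le_of_eq hX1_5)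
    have hm9_9_0 := hmul ({T : Set α | T ⊆ V ∧ T.ncard = 9 ∧ M.eRk T = (0 : ℕ∞)}.ncard) _ _ hX0_0; have hm9_9_1 := hmul ({T : Set α | T ⊆ V ∧ T.ncard = 9 ∧ M.eRk T = (1 : ℕ∞)}.ncard) _ _ hX0_1; have hm9_9_2 := hmul ({T : Set α | T ⊆ V ∧ T.ncard = 9 ∧ M.eRk T = (2 : ℕ∞)}.ncard) _ _ hX0_2; have hm9_9_3 := hmul ({T : Set α | T ⊆ V ∧ T.ncard = 9 ∧ M.eRk T = (3 : ℕ∞)}.ncard) _ _ hX0_3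
    have hm9_9_4 := hmul ({T : Set α | T ⊆ V ∧ T.ncard = 9 ∧ M.eRk T = (4 : ℕ∞)}.ncard) _ _ hX0_4; have hm9_9_5 := hmul ({T : Set α | T ⊆ V ∧ T.ncard = 9 ∧ M.eRk T = (5 : ℕ∞)}.ncard) _ _ hX0_5
    omega
  have hU10 : {B : Set α | B ⊆ M.E ∧ B.ncard = 10 ∧ M.eRk B = 5 ∧ M.eRk (M.E \ B) = M.eRank}.ncard ≤ 10582 := by
    have htop10 := S2.ncard_top_le_sum_contract_rank_exact M hVE 10 8 hhit10
    simp only [Finset.sum_Icc_succ_top (by norm_num : 8 ≤ 10), Finset.sum_Icc_succ_top (by norm_num : 8 ≤ 9), Finset.Icc_self, Finset.sum_singleton, Finset.sum_range_succ, Finset.sum_range_zero,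
      Nat.cast_zero, Nat.cast_one, Nat.cast_ofNat, zero_add, Nat.reduceAdd, Nat.reduceSub] at htop10
    have hm10_8_0 := hmul ({T : Set α | T ⊆ V ∧ T.ncard = 8 ∧ M.eRk T = (0 : ℕ∞)}.ncard) _ _ hX2_0; have hm10_8_1 := hmul ({T : Set α | T ⊆ V ∧ T.ncard = 8 ∧ M.eRk T = (1 : ℕ∞)}.ncard) _ _ hX2_1; have hm10_8_2 := hmul ({T : Set α | T ⊆ V ∧ T.ncard = 8 ∧ M.eRk T = (2 : ℕ∞)}.ncard) _ _ hX2_2; have hm10_8_3 := hmul ({T : Set α | T ⊆ V ∧ T.ncard = 8 ∧ M.eRk T = (3 : ℕ∞)}.ncard) _ _ hX2_3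
    have hm10_8_4 := hmul ({T : Set α | T ⊆ V ∧ T.ncard = 8 ∧ M.eRk T = (4 : ℕ∞)}.ncard) _ _ hX2_4; have hm10_8_5 := hmul ({T : Set α | T ⊆ V ∧ T.ncard = 8 ∧ M.eRk T = (5 : ℕ∞)}.ncard) _ _ (le_of_eq hX2_5); have hm10_9_0 := hmul ({T : Set α | T ⊆ V ∧ T.ncard = 9 ∧ M.eRk T = (0 : ℕ∞)}.ncard) _ _ hX1_0; have hm10_9_1 := hmul ({T : Set α | T ⊆ V ∧ T.ncard = 9 ∧ M.eRk T = (1 : ℕ∞)}.ncard) _ _ hX1_1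
    have hm10_9_2 := hmul ({T : Set α | T ⊆ V ∧ T.ncard = 9 ∧ M.eRk T = (2 : ℕ∞)}.ncard) _ _ hX1_2; have hm10_9_3 := hmul ({T : Set α | T ⊆ V ∧ T.ncard = 9 ∧ M.eRk T = (3 : ℕ∞)}.ncard) _ _ hX1_3; have hm10_9_4 := hmul ({T : Set α | T ⊆ V ∧ T.ncard = 9 ∧ M.eRk T = (4 : ℕ∞)}.ncard) _ _ hX1_4; have hm10_9_5 := hmul ({T : Set α | T ⊆ V ∧ T.ncard = 9 ∧ M.eRk T = (5 : ℕ∞)}.ncard) _ _ (le_of_eq hX1_5)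
    have hm10_10_0 := hmul ({T : Set α | T ⊆ V ∧ T.ncard = 10 ∧ M.eRk T = (0 : ℕ∞)}.ncard) _ _ hX0_0; have hm10_10_1 := hmul ({T : Set α | T ⊆ V ∧ T.ncard = 10 ∧ M.eRk T = (1 : ℕ∞)}.ncard) _ _ hX0_1; have hm10_10_2 := hmul ({T : Set α | T ⊆ V ∧ T.ncard = 10 ∧ M.eRk T = (2 : ℕ∞)}.ncard) _ _ hX0_2; have hm10_10_3 := hmul ({T : Set α | T ⊆ V ∧ T.ncard = 10 ∧ M.eRk T = (3 : ℕ∞)}.ncard) _ _ hX0_3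
    have hm10_10_4 := hmul ({T : Set α | T ⊆ V ∧ T.ncard = 10 ∧ M.eRk T = (4 : ℕ∞)}.ncard) _ _ hX0_4; have hm10_10_5 := hmul ({T : Set α | T ⊆ V ∧ T.ncard = 10 ∧ M.eRk T = (5 : ℕ∞)}.ncard) _ _ hX0_5
    omega
  have hU' : Matroid.topCount M 12 5 ≤ 118234 := by omega
  exact hU'

end ThmN

end PercRepro
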